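import Mathlib
import Summits.NavierStokesRegularity.NavierStokesRegularity.Theorems.SubOnsagerCeilingKPNetRealization
import HarnessLib

/-!
# The four-mode REACH PIPELINE — the measured worst case of the stubs of `ForwardTailCeilingKP` — is a table of `E₂(75)`
# (helper file for the crux `SubOnsagerCeiling.ForwardTailCeilingKP`, stmt-NavierStokesRegularity-27057, `--supports`;
# companion of `Theorems/SubOnsagerCeilingKPNetRealization.lean`)

The numerics of this hand (evidence `REACH-LOOPS-leafhand4-g3.md` on the item; windowed Dormand–Prince integration of the inviscid
front, calibrated on the chain `θ_f(1.10) = 0.6035` and the side loop `0.5836` of hands leafhand-4-g0/4-g2) locate the smallest front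
exponent found among non-negative feed/pump networks on FOUR modes at the «reach pipeline»: in-shell pumps `0 → 1 → 2 → 3` (weight `1`),
forward feeds `W = [[.123,.078,0,0],[0,.091,.091,0],[0,0,.027,.121],[1,.121,.135,.067]]` (row `a` feeds column `e` one shell up: every
mode feeds itself and its successor, the last mode returns to mode `0`), scale ratio `b ≈ 1.14`: per-shell peaks decay like `b^{-θ_f n}`
with `θ_f = 0.5537` — margin `0.054` above the kill line `θ = 1/2` of the crux (chain: `0.10`).  This file records, by
`Theorems.kpNet_realization`, that this network IS a table of `E₂(75)`, orthant, with diagonal feeds, these feed and pump matrices and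
no differential triads (`kpNet_reachPipelineFour_nonempty`), and that — all four modes being self-fed — the body of `PrimaryGradedAt`
binds EVERY mode of it in every structural grading (`kpNet_reachPipelineFour_allPrimary`).  So both registered stubs assert, BY NAME, a
ν-uniform `θ`-barrier with `θ > 1/2` on all four modes of this network at `ε₀ ≈ 0.14` (inside `stub_primaryGradedSmallRatio`).
HONEST FRAMING: MODEL lattice algebra + a docstring number from heuristic numerics; no stub, crux or summit is proved; nothing here
bears on Navier–Stokes regularity. [cite: Tao2016AveragedNS, §4 (4.2)–(4.3)]
-/

noncomputable section

-- the sub-problem namespace `NavierStokesRegularity.NavierStokesRegularity` is the tree's layout (D-0017)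
set_option linter.dupNamespace false

namespace Summit.NavierStokesRegularity.NavierStokesRegularity.Theorems

open Literature.Analysis.FluidPDE.TaoCascade

/-- **The four-mode reach pipeline exists inside the crux's hypotheses**: there is a table of `E₂(75)`, orthant, with diagonal feeds,
whose feed matrix is `W = [[123,78,0,0],[0,91,91,0],[0,0,27,121],[1000,121,135,67]]/1000` and whose pump matrix is the shift
`0 → 1 → 2 → 3` with unit weights, without differential triads (measured front exponent `θ_f = 0.5537` at `b ≈ 1.14`). [this file] -/
theorem kpNet_reachPipelineFour_nonempty :
    ∃ α : Fin 4 → Fin 4 → Fin 4 → ℤ × ℤ × ℤ → ℝ,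
    Literature.Analysis.FluidPDE.TaoCascade.InTableClass 75 α ∧
    (∀ (Y : Fin 4 → ℤ → ℝ → ℝ) (τ : ℝ), (∀ (j : Fin 4) (k : ℤ), 1 ≤ k → 0 ≤ Y j k τ) →
      ∀ δ : ℝ, 0 < δ → ∀ (i : Fin 4) (n : ℤ), 1 ≤ n → Y i n τ = 0 → 0 ≤ quadTerm δ α Y i n τ) ∧
    (∀ a b i : Fin 4, a ≠ b → α a b i (0, 0, 1) = 0) ∧
    (∀ a e : Fin 4, α a a e (0, 0, 1) =
      (![![(123 : ℝ) / 1000, 78 / 1000, 0, 0], ![0, 91 / 1000, 91 / 1000, 0], ![0, 0, 27 / 1000, 121 / 1000],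
        ![1, 121 / 1000, 135 / 1000, 67 / 1000]] : Fin 4 → Fin 4 → ℝ) a e) ∧
    (∀ a d : Fin 4, a ≠ d → α a a d (0, 0, 0) =
      (![![(0 : ℝ), 1, 0, 0], ![0, 0, 1, 0], ![0, 0, 0, 1], ![0, 0, 0, 0]] : Fin 4 → Fin 4 → ℝ) a d) ∧
    (∀ a b c : Fin 4, a ≠ b → a ≠ c → b ≠ c → α a b c (0, 0, 0) = 0) := by
  refine kpNet_realization (R := 75) (by norm_num) _ _ ?_ ?_ ?_ ?_ ?_ ?_ ?_
  · intro a e; fin_cases a <;> fin_cases e <;> simp <;> norm_num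
  · intro a e; fin_cases a <;> fin_cases e <;> simp <;> norm_num
  · intro a e; fin_cases a <;> fin_cases e <;> simp <;> norm_num
  · intro a d; fin_cases a <;> fin_cases d <;> simp
  · intro a d; fin_cases a <;> fin_cases d <;> simp
  · intro a d; fin_cases a <;> fin_cases d <;> simp <;> norm_num
  · intro a; fin_cases a <;> simp

/-- **Every mode of the reach pipeline is primary in every structural grading** (all four modes are self-fed; `kpNet_selfFeed_primary`),
so the body of `PrimaryGradedAt R ε₀ α` for this table bounds `(1+ε₀)^{2θk}·½x_{i,k}(t)²` for EVERY `i`. [this file] -/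
theorem kpNet_reachPipelineFour_allPrimary {α : Fin 4 → Fin 4 → Fin 4 → ℤ × ℤ × ℤ → ℝ}
    (hW : ∀ a e : Fin 4, α a a e (0, 0, 1) =
      (![![(123 : ℝ) / 1000, 78 / 1000, 0, 0], ![0, 91 / 1000, 91 / 1000, 0], ![0, 0, 27 / 1000, 121 / 1000],
        ![1, 121 / 1000, 135 / 1000, 67 / 1000]] : Fin 4 → Fin 4 → ℝ) a e)
    (lev : Fin 4 → ℕ)
    (hstruct : ∀ a, lev a ≠ 0 → (∃ e, α a a e (0, 0, 1) ≠ 0) →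
      (∀ j, α j j a (0, 0, 1) ≠ 0 → lev j < lev a ∧ (lev j = 0 ∨ ∃ e', α j j e' (0, 0, 1) ≠ 0)) ∧
      (∀ i₁ i₂, i₁ ≠ a → i₂ ≠ a → α i₁ i₂ a (0, 0, 0) ≠ 0 →
        (lev i₁ < lev a ∧ (lev i₁ = 0 ∨ ∃ e', α i₁ i₁ e' (0, 0, 1) ≠ 0)) ∧
        (lev i₂ < lev a ∧ (lev i₂ = 0 ∨ ∃ e', α i₂ i₂ e' (0, 0, 1) ≠ 0))) ∧
      (∃ e, α a a e (0, 0, 1) ≠ 0 ∧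
        (∀ j, α e e j (0, 0, 1) ≠ 0 → lev j < lev a ∧ (lev j = 0 ∨ ∃ e', α j j e' (0, 0, 1) ≠ 0)) ∧
        (∀ j, j ≠ e → α e e j (0, 0, 0) ≠ 0 →
          lev j < lev a ∧ (lev j = 0 ∨ ∃ e', α j j e' (0, 0, 1) ≠ 0)))) :
    ∀ i : Fin 4, lev i = 0 := by
  intro i
  refine kpNet_selfFeed_primary lev hstruct ?_
  rw [hW]
  fin_cases i <;> simp

end Summit.NavierStokesRegularity.NavierStokesRegularity.Theorems

end
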